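import Literature.NumberTheory.LFunctions.LFDSingleDetect
import Literature.NumberTheory.Sieve.GreenTao2008SharpGYTwoLevel
import HarnessLib

/-!
# Log-free zero density for one character, III: the arithmetic factor `(φ(q)/q) D_q(1)`

Topic `Literature/NumberTheory/LFunctions`, sub-namespace `LFDSingle`. Everything here is PROVED.
The residue of the Gram entries of part II carries the factor `E_q(1) D_q(1) = (φ(q)/q) D_q(1)`,
`D_q(1) = Σ_{d,e ≤ W, (de,q)=1} θ_d θ_e/[d,e]` (`= Fpoly 1 1 W W 1` with the trivial character).
By Selberg's diagonalisation (`GrahamWeights.sum_sum_mul_lcm_rpow_eq` at `ω = 1`),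
`D_q(1) = Σ_{(r,q)=1} φ(r) y_r²` with
`y_r = μ(r)/(r log W) · Σ_{m ≤ W/r, (m, rq)=1} μ(m)/m · log(W/(rm))`, whence
`|y_r| ≤ 7 (r/φ(r))(q/φ(q))/(r log W)` (Graham's Lemma 2, the tree's coprime Möbius log sums) and

  `(φ(q)/q) D_q(1) ≤ 49 (log W + C_G (7 + log q))/log² W`

(`totient_div_mul_Dq_le`) by Green–Tao's `Σ_{r ≤ W,(r,q)=1} μ²(r)/φ(r) = (φ(q)/q)(log W + O(1 + Σ_{p∣q} log p/p))`
(`GYCorr.exists_abs_invTotSum_sub_le`). This is the "`1/log W`" saving of the one-level Graham weights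
for the trivial character (Heath-Brown (11.17)), uniformly in `q`, with no loss of `q/φ(q)`.

## References
* D. R. Heath-Brown, PLMS 64 (1992), §11 (11.17). [cite: HeathBrown1992PLMS, §11]
* S. W. Graham, J. Number Theory 10 (1978), Lemma 2. [folklore]
-/

noncomputable section

open Finset Real Complex ArithmeticFunction
open Literature.NumberTheory.Sieve Literature.NumberTheory.Sieve.GrahamWeights

open scoped ArithmeticFunction.Moebius

namespace Literature.NumberTheory.LFunctions.LFDSingle

variable {q : ℕ} {W : ℝ}

/-! ### The real form of `D_q(1)` -/

/-- `a_d = θ_d 𝟙_{(d,q)=1}` (`θ = ψ` with `U = 1`, `V = W`). [folklore] -/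
def acoef (q : ℕ) (W : ℝ) (d : ℕ) : ℝ := psi 1 W d * (if d.Coprime q then 1 else 0)

/-- `D_q(1) = Σ_{d,e ≤ ⌊W⌋} a_d a_e [d,e]^{-1}` (real). [cite: HeathBrown1992PLMS, §11 (11.17)] -/
def Dq1 (q : ℕ) (W : ℝ) : ℝ :=
  ∑ d ∈ Icc 1 ⌊W⌋₊, ∑ e ∈ Icc 1 ⌊W⌋₊, acoef q W d * acoef q W e * ((Nat.lcm d e : ℕ) : ℝ) ^ (-(1 : ℝ))

/-- `([d,e], q) = 1 ↔ (d,q) = 1 ∧ (e,q) = 1`. [folklore] -/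
theorem coprime_lcm_iff {d e q : ℕ} : (Nat.lcm d e).Coprime q ↔ d.Coprime q ∧ e.Coprime q := by
  constructor
  · intro h
    exact ⟨h.coprime_dvd_left (Nat.dvd_lcm_left d e), h.coprime_dvd_left (Nat.dvd_lcm_right d e)⟩
  · rintro ⟨hd, he⟩
    exact (Nat.Coprime.mul_left hd he).coprime_dvd_left (Nat.lcm_dvd_mul d e)

/-- The trivial character: `χ₀(n) = 𝟙_{(n,q)=1}`. [folklore] -/
theorem one_apply_natCast (q n : ℕ) :
    (1 : DirichletCharacter ℂ q) (n : ZMod q) = if n.Coprime q then 1 else 0 := by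
  by_cases h : n.Coprime q
  · rw [if_pos h, MulChar.one_apply ((ZMod.isUnit_iff_coprime n q).2 h)]
  · rw [if_neg h, MulChar.map_nonunit _ (mt (ZMod.isUnit_iff_coprime n q).1 h)]

/-- `Fpoly χ₀ 1 W W 1 = D_q(1)` as a real number. [folklore] -/
theorem Fpoly_one_eq_Dq1 (q : ℕ) (W : ℝ) :
    Fpoly (1 : DirichletCharacter ℂ q) 1 W W 1 = ((Dq1 q W : ℝ) : ℂ) := by
  rw [Fpoly, Dq1]
  push_cast
  refine sum_congr rfl fun d hd => sum_congr rfl fun e he => ?_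
  have hd0 : 0 < d := (mem_Icc.1 hd).1
  have he0 : 0 < e := (mem_Icc.1 he).1
  have hl : 0 < Nat.lcm d e := Nat.pos_of_ne_zero (Nat.lcm_ne_zero hd0.ne' he0.ne')
  rw [one_apply_natCast, acoef, acoef]
  have hcpow : ((Nat.lcm d e : ℕ) : ℂ) ^ (-(1 : ℂ)) = ((((Nat.lcm d e : ℕ) : ℝ) ^ (-(1 : ℝ)) : ℝ) : ℂ) := by
    rw [Complex.ofReal_cpow (by positivity)]; simp
  rw [hcpow]
  by_cases hd' : d.Coprime q
  · by_cases he' : e.Coprime q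
    · rw [if_pos (coprime_lcm_iff.2 ⟨hd', he'⟩), if_pos hd', if_pos he']; push_cast; ring
    · rw [if_neg (fun h => he' (coprime_lcm_iff.1 h).2), if_neg he']; push_cast; ring
  · rw [if_neg (fun h => hd' (coprime_lcm_iff.1 h).1), if_neg hd']; push_cast; ring

/-! ### Diagonalisation and the diagonal coefficients -/

/-- `a` vanishes off the square-free numbers. [folklore] -/
theorem acoef_eq_zero_of_not_squarefree (q : ℕ) (W : ℝ) {d : ℕ} (hd : ¬Squarefree d) : acoef q W d = 0 := by
  rw [acoef, psi_eq_zero_of_not_squarefree 1 W hd, zero_mul]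

/-- `φ_1(r) = φ(r)` for square-free `r`. [folklore] -/
theorem phiOmega_one_eq_totient {r : ℕ} (hr : Squarefree r) : phiOmega 1 r = (r.totient : ℝ) := by
  have hr' : (r : ℝ) = ∏ p ∈ r.primeFactors, (p : ℝ) := by
    rw [← Nat.cast_prod, Nat.prod_primeFactors_of_squarefree hr]
  rw [Literature.NumberTheory.LFunctions.MertensBound.totient_eq_mul_prod_one_sub_inv r, hr', phiOmega,
    ← prod_mul_distrib]
  refine prod_congr rfl fun p hp => ?_
  have hp0 : (p : ℝ) ≠ 0 := by exact_mod_cast (Nat.prime_of_mem_primeFactors hp).ne_zero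
  rw [Real.rpow_one]; field_simp

/-- The diagonal coefficient `y_r = Σ_{d ≤ ⌊W⌋, r ∣ d} a_d/d` vanishes unless `(r, q) = 1`. [folklore] -/
theorem diagA_eq_zero_of_not_coprime (W : ℝ) {r : ℕ} (hr : ¬r.Coprime q) :
    ∑ d ∈ (Icc 1 ⌊W⌋₊).filter (fun d => r ∣ d), acoef q W d * (d : ℝ) ^ (-(1 : ℝ)) = 0 := by
  refine sum_eq_zero fun d hd => ?_
  have hrd : r ∣ d := (mem_filter.1 hd).2
  have : ¬d.Coprime q := fun h => hr (h.coprime_dvd_left hrd)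
  simp [acoef, this]

/-- For `(r, q) = 1`, `r ≥ 1`, `1 < W`:
`y_r = μ(r) r^{-1} T_{rq}(W/r)/log W` with the `δ = 0` twisted sum of `GrahamWeights`. [folklore] -/
theorem diagA_eq (hW : 1 < W) {r : ℕ} (hr : 0 < r) (hrq : r.Coprime q) :
    ∑ d ∈ (Icc 1 ⌊W⌋₊).filter (fun d => r ∣ d), acoef q W d * (d : ℝ) ^ (-(1 : ℝ)) =
      (μ r : ℝ) * (r : ℝ)⁻¹ / Real.log W * twSum (r * q) 0 (W / r) := by
  have hr0 : (0 : ℝ) < r := by exact_mod_cast hr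
  have hW0 : 0 < W := by linarith
  set N : ℕ := ⌊W⌋₊ with hN
  -- reindex `d = r m`
  have hreindex : (Icc 1 N).filter (fun d => r ∣ d) = (Icc 1 (N / r)).image (fun m => r * m) := by
    ext d
    simp only [mem_filter, mem_Icc, mem_image]
    constructor
    · rintro ⟨⟨hd1, hdN⟩, ⟨m, rfl⟩⟩
      refine ⟨m, ⟨?_, ?_⟩, rfl⟩
      · rcases Nat.eq_zero_or_pos m with rfl | hm
        · simp at hd1
        · exact hm
      · exact (Nat.le_div_iff_mul_le hr).2 (by rw [mul_comm]; exact hdN)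
    · rintro ⟨m, ⟨hm1, hmN⟩, rfl⟩
      refine ⟨⟨Nat.mul_pos hr hm1, ?_⟩, dvd_mul_right r m⟩
      have := (Nat.le_div_iff_mul_le hr).1 hmN
      rw [mul_comm]; exact this
  rw [hreindex, sum_image (fun a _ b _ h => Nat.eq_of_mul_eq_mul_left hr h)]
  have hMV : ⌊W / r⌋₊ ≤ N / r := floor_div_le le_rfl r
  rw [twSum_eq_sum_max 0 (div_nonneg hW0.le hr0.le) hMV, mul_sum]
  refine sum_congr rfl fun m hm => ?_
  have hm0 : 0 < m := (mem_Icc.1 hm).1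
  have hm0' : (0 : ℝ) < m := by exact_mod_cast hm0
  -- the coprimality conditions
  have hcop_iff : m.Coprime (r * q) ↔ m.Coprime r ∧ m.Coprime q := Nat.coprime_mul_iff_right
  by_cases hmr : m.Coprime r
  · by_cases hmq : m.Coprime q
    · rw [if_pos (hcop_iff.2 ⟨hmr, hmq⟩)]
      have hrmq : (r * m).Coprime q := Nat.Coprime.mul_left hrq hmq
      have hμ : (μ (r * m) : ℝ) = μ r * μ m := by
        have := ArithmeticFunction.isMultiplicative_moebius.map_mul_of_coprime hmr.symm
        exact_mod_cast this
      have hrm : ((r * m : ℕ) : ℝ) ^ (-(1 : ℝ)) = (r : ℝ)⁻¹ * (m : ℝ)⁻¹ := by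
        rw [Nat.cast_mul, Real.rpow_neg (by positivity), Real.rpow_one, mul_inv]
      have htaper : taper 1 W (r * m) = max 0 (Real.log (W / r / m)) / Real.log (W / 1) := by
        rw [taper, Nat.cast_mul, div_div]
        have : max 0 (Real.log (1 / ((r : ℝ) * m))) = 0 := by
          refine max_eq_left (Real.log_nonpos (by positivity) ?_)
          rw [div_le_one (by positivity)]
          have : (1 : ℝ) ≤ r := by exact_mod_cast hr
          have : (1 : ℝ) ≤ m := by exact_mod_cast hm0
          nlinarith
        rw [this, sub_zero]
      rw [acoef, if_pos hrmq, mul_one, psi, hμ, htaper, hrm, div_one, neg_zero, Real.rpow_zero]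
      field_simp
    · rw [if_neg (fun h => hmq (hcop_iff.1 h).2)]
      have : ¬(r * m).Coprime q := fun h => hmq (h.coprime_dvd_left (dvd_mul_left m r))
      simp [acoef, this]
  · rw [if_neg (fun h => hmr (hcop_iff.1 h).1), mul_zero]
    have hns : ¬Squarefree (r * m) := fun hsq => hmr ((Nat.squarefree_mul_iff.1 hsq).1).symm
    rw [acoef_eq_zero_of_not_squarefree q W hns, zero_mul]

/-- **Bound for the diagonal coefficients**: for `1 < W`, `1 ≤ r` and `q ≥ 1`,
`|y_r| ≤ 7 (r/φ(r)) (q/φ(q)) / (r log W)`. [folklore] -/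
theorem abs_diagA_le (hq : q ≠ 0) (hW : 1 < W) {r : ℕ} (hr : 0 < r) :
    |∑ d ∈ (Icc 1 ⌊W⌋₊).filter (fun d => r ∣ d), acoef q W d * (d : ℝ) ^ (-(1 : ℝ))| ≤
      7 * ((r : ℝ) / r.totient) * ((q : ℝ) / q.totient) / (r * Real.log W) := by
  have hlogW : 0 < Real.log W := Real.log_pos hW
  have hr0 : (0 : ℝ) < r := by exact_mod_cast hr
  by_cases hrq : r.Coprime q
  · rw [diagA_eq hW hr hrq]
    have hrq0 : r * q ≠ 0 := mul_ne_zero hr.ne' hq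
    have hT := abs_twSum_le hrq0 le_rfl (Y := W / r) (W := W)
      (div_le_self (by linarith) (by exact_mod_cast hr)) hW.le
    rw [zero_mul, add_zero, mul_one] at hT
    have hmul : ((r * q : ℕ) : ℝ) / (r * q).totient = (r : ℝ) / r.totient * ((q : ℝ) / q.totient) := by
      rw [Nat.totient_mul hrq]; push_cast
      have h1 : (0 : ℝ) < r.totient := by exact_mod_cast Nat.totient_pos.2 hr
      have h2 : (0 : ℝ) < q.totient := by exact_mod_cast Nat.totient_pos.2 (Nat.pos_of_ne_zero hq)
      field_simp
    have h6 : (6 : ℝ) ≤ 6 * ((r : ℝ) / r.totient * ((q : ℝ) / q.totient)) := by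
      have h1 : 1 ≤ (r : ℝ) / r.totient := by
        rw [le_div_iff₀ (by exact_mod_cast Nat.totient_pos.2 hr), one_mul]; exact_mod_cast Nat.totient_le r
      have h2 : 1 ≤ (q : ℝ) / q.totient := by
        rw [le_div_iff₀ (by exact_mod_cast Nat.totient_pos.2 (Nat.pos_of_ne_zero hq)), one_mul]
        exact_mod_cast Nat.totient_le q
      nlinarith
    have hμ : |(μ r : ℝ)| ≤ 1 := by exact_mod_cast ArithmeticFunction.abs_moebius_le_one (n := r)
    rw [abs_mul, abs_div, abs_mul, abs_of_pos hlogW, abs_of_pos (inv_pos.2 hr0)]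
    rw [hmul] at hT
    have h1 : |(μ r : ℝ)| * (r : ℝ)⁻¹ / Real.log W ≤ 1 * (r : ℝ)⁻¹ / Real.log W := by
      gcongr
    have h2 : |twSum (r * q) 0 (W / r)| ≤ 7 * ((r : ℝ) / r.totient * ((q : ℝ) / q.totient)) := by
      linarith
    calc |(μ r : ℝ)| * (r : ℝ)⁻¹ / Real.log W * |twSum (r * q) 0 (W / r)|
        ≤ 1 * (r : ℝ)⁻¹ / Real.log W * (7 * ((r : ℝ) / r.totient * ((q : ℝ) / q.totient))) :=
          mul_le_mul h1 h2 (abs_nonneg _) (by positivity)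
      _ = _ := by field_simp
  · rw [diagA_eq_zero_of_not_coprime W hrq, abs_zero]
    positivity

/-- `Σ_{p ∣ q} log p / p ≤ log q`. [folklore] -/
theorem sum_primeFactors_log_div_le_log (hq : q ≠ 0) :
    ∑ p ∈ q.primeFactors, Real.log p / p ≤ Real.log q := by
  have h1 : ∑ p ∈ q.primeFactors, Real.log p / p ≤ ∑ p ∈ q.primeFactors, Real.log p := by
    refine sum_le_sum fun p hp => ?_
    have hpr := Nat.prime_of_mem_primeFactors hp
    have hp1 : (1 : ℝ) ≤ p := by exact_mod_cast hpr.one_le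
    exact div_le_self (Real.log_nonneg hp1) hp1
  refine h1.trans ?_
  rw [← Real.log_prod fun p hp => by exact_mod_cast (Nat.prime_of_mem_primeFactors hp).ne_zero,
    ← Nat.cast_prod]
  exact Real.log_le_log (by exact_mod_cast Finset.prod_pos fun p hp => (Nat.prime_of_mem_primeFactors hp).pos)
    (by exact_mod_cast Nat.le_of_dvd (Nat.pos_of_ne_zero hq) (Nat.prod_primeFactors_dvd q))

/-- **The arithmetic factor.** There is an absolute `C_G ≥ 0` such that for all `q ≥ 1` and `W > 1`:
`0 ≤ D_q(1)` and `(φ(q)/q) D_q(1) ≤ 49 (log W + C_G (7 + log q)) / log² W`.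
[cite: HeathBrown1992PLMS, §11 (11.17)] -/
theorem exists_totient_div_mul_Dq1_le :
    ∃ C_G : ℝ, 0 ≤ C_G ∧ ∀ (q : ℕ), q ≠ 0 → ∀ W : ℝ, 1 < W →
      0 ≤ Dq1 q W ∧
      (q.totient : ℝ) / q * Dq1 q W ≤ 49 * (Real.log W + C_G * (7 + Real.log q)) / Real.log W ^ 2 := by
  obtain ⟨C_G, hC_G, hG⟩ := GreenTao2008.GYCorr.exists_abs_invTotSum_sub_le
  refine ⟨C_G, hC_G, fun q hq W hW => ?_⟩
  have hlogW : 0 < Real.log W := Real.log_pos hW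
  have hq0 : (0 : ℝ) < q := by exact_mod_cast Nat.pos_of_ne_zero hq
  have hφ0 : (0 : ℝ) < q.totient := by exact_mod_cast Nat.totient_pos.2 (Nat.pos_of_ne_zero hq)
  set N : ℕ := ⌊W⌋₊ with hN
  -- diagonalise
  have hdiag := sum_sum_mul_lcm_rpow_eq (acoef q W) (fun d hd => acoef_eq_zero_of_not_squarefree q W hd) 1 N
  have hD : Dq1 q W = ∑ r ∈ Icc 1 N, phiOmega 1 r *
      (∑ d ∈ (Icc 1 N).filter (fun d => r ∣ d), acoef q W d * (d : ℝ) ^ (-(1 : ℝ))) ^ 2 := hdiag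
  -- each term
  set B : ℝ := 7 * ((q : ℝ) / q.totient) / Real.log W with hB
  have hterm : ∀ r ∈ Icc 1 N, phiOmega 1 r *
      (∑ d ∈ (Icc 1 N).filter (fun d => r ∣ d), acoef q W d * (d : ℝ) ^ (-(1 : ℝ))) ^ 2 ≤
      if Squarefree r ∧ r.Coprime q then B ^ 2 * (1 / (r.totient : ℝ)) else 0 := by
    intro r hr
    have hr0 : 0 < r := (mem_Icc.1 hr).1
    have hr0' : (0 : ℝ) < r := by exact_mod_cast hr0
    by_cases hsq : Squarefree r
    · by_cases hrq : r.Coprime q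
      · rw [if_pos ⟨hsq, hrq⟩, phiOmega_one_eq_totient hsq]
        have hy := abs_diagA_le hq hW hr0
        rw [← hN] at hy
        set y := ∑ d ∈ (Icc 1 N).filter (fun d => r ∣ d), acoef q W d * (d : ℝ) ^ (-(1 : ℝ)) with hy'
        have hφr : (0 : ℝ) < r.totient := by exact_mod_cast Nat.totient_pos.2 hr0
        have hyb : |y| ≤ B / r.totient := by
          refine hy.trans (le_of_eq ?_)
          rw [hB]; field_simp
        have hysq : y ^ 2 ≤ (B / r.totient) ^ 2 := by
          calc y ^ 2 = |y| ^ 2 := (sq_abs y).symm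
            _ ≤ (B / r.totient) ^ 2 := by gcongr
        calc (r.totient : ℝ) * y ^ 2 ≤ (r.totient : ℝ) * (B / r.totient) ^ 2 :=
              mul_le_mul_of_nonneg_left hysq hφr.le
          _ = B ^ 2 * (1 / (r.totient : ℝ)) := by field_simp
      · rw [if_neg (fun h => hrq h.2), diagA_eq_zero_of_not_coprime W hrq]; simp
    · rw [if_neg (fun h => hsq h.1)]
      have : ∑ d ∈ (Icc 1 N).filter (fun d => r ∣ d), acoef q W d * (d : ℝ) ^ (-(1 : ℝ)) = 0 := by
        refine sum_eq_zero fun d hd => ?_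
        have hrd : r ∣ d := (mem_filter.1 hd).2
        have : ¬Squarefree d := fun hds => hsq (hds.squarefree_of_dvd hrd)
        rw [acoef_eq_zero_of_not_squarefree q W this, zero_mul]
      rw [this]; simp
  have hnonneg : 0 ≤ Dq1 q W := by
    rw [hD]
    exact sum_nonneg fun r hr => mul_nonneg (phiOmega_nonneg zero_le_one r) (sq_nonneg _)
  refine ⟨hnonneg, ?_⟩
  have hDle : Dq1 q W ≤ B ^ 2 * GreenTao2008.SharpGY.invTotSum q W := by
    rw [hD]
    refine (sum_le_sum hterm).trans ?_
    rw [← sum_filter, ← mul_sum, GreenTao2008.SharpGY.invTotSum]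
  have hinv : GreenTao2008.SharpGY.invTotSum q W ≤ (q.totient : ℝ) / q * (Real.log W + C_G * (7 + Real.log q)) := by
    have h := hG q hq W hW.le
    have hS := sum_primeFactors_log_div_le_log hq
    have h' := (abs_le.1 h).2
    have : (q.totient : ℝ) / q * (C_G * (7 + ∑ p ∈ q.primeFactors, Real.log p / p)) ≤
        (q.totient : ℝ) / q * (C_G * (7 + Real.log q)) := by
      gcongr
    linarith
  calc (q.totient : ℝ) / q * Dq1 q W ≤ (q.totient : ℝ) / q * (B ^ 2 * GreenTao2008.SharpGY.invTotSum q W) :=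
        mul_le_mul_of_nonneg_left hDle (by positivity)
    _ ≤ (q.totient : ℝ) / q * (B ^ 2 * ((q.totient : ℝ) / q * (Real.log W + C_G * (7 + Real.log q)))) := by
        gcongr
    _ = 49 * (Real.log W + C_G * (7 + Real.log q)) / Real.log W ^ 2 := by
        rw [hB]; field_simp; norm_num

end Literature.NumberTheory.LFunctions.LFDSingle
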